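import Summits.QuantumFields.BalabanUV.Beta.NVertexLamStraightPullback
import Summits.QuantumFields.BalabanUV.Beta.BlockMeanChartK1Row

/-!
# `BalabanUV.Beta.NVertexColumnK1Row` — row D1 ∕ (C1) OWNER an2 (gen 63), PART 22: **THE (K1) ROW FOR THE COMPOSITE ONE-SHOT COLUMN ON `ℤ⁴`, AT EVERY DEPTH**
# — for the column `colN := colH (AN R j) L μ y` of the composite one-shot chart of record (`L = Lc^(j+1)`, any roots `R`, any `j`):
# (i) `colN = Ψ̂_{j+1}(Π_bm ℋ_L(·; μ, y))` (the corrector applied to the block-mean-dressed STRAIGHT column), hence `E″ colN = E″ ℋ_L(·; μ, y)`;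
# (ii) `Λ′_N μ y = −Φ^ℋ_L(·; μ, y)` — THE CONTRACTED MULTIPLIER RESPONSE IS MINUS THE STRAIGHT COLUMN's OWN MULTIPLIER (the general-depth twin of g60 PART 3∕7);
# (iii) **(K1) for the composite column**: `(E″ colN)(f) = −⟪Λ′_N μ y, straightCount L · · f⟫ = −(Lc⁴)^{j+1}·Σ_{κ₁} Σ'_{s₁} λ′ᴿ_j (κ₁,s₁)·symLinKerAt (toSite R.r) Lc κ₁ s₁ f`
# — the END wrapper's finest-level (K1) shape with the FULLY TRANSPORTED weight (an2 storey 0; J-NOTE-1), `α = −(Lc⁴)^{j+1}` (Engine C K1.md: `−81` at depth 1, `Lc = 3`)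

HONEST FRAMING (cell charter, verbatim): «discharging `BetaPertH` makes Bałaban's UV stability UNCONDITIONAL — a real constructive-QFT result; it
is NOT the continuum limit and NOT the Clay problem.»  THIS MODULE DISCHARGES NOTHING of `BetaPertH` ∕ row D1 and NOT the END wrapper's (K1) (that row is DISPLAYED on
the tower TORUS, periodised, for the road's `hb ∕ cf` data — the road's instantiation, SPEC-51 §D): it is the `ℤ⁴` identity behind it, [folklore] bookkeeping BY NAME
over the cell's OWN objects — F6e∕K-U3d's chart `CompositeCorrectorDress.compChart = Ψ̂∘coDressKBmAt (toSite s) N KInv∘Ψ̂ᵀ` (`CompositeOneShotJetData.AN_eq`) read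
through K-U3d L2's APPLY BRIDGES `CompositeCorrectorKernel.comp_psiK_inl ∕ comp_trK_psiK_inr` (no hypothesis on the kernel), L1's `CompositeCorrectorForms.corrPsi`
(`Ψ_m A = A + c•dz (ext …)`, `curv_corrPsi`), an2 g60 PART 7 `BlockMeanChartK1Row` (`coProjBmW_Hcol_eq_colH_coDressKBmAt`, `curvAdj_curv_coProjBmW`,
`lamCovector_coProjBmW`), PART 3 `StraightColumnK1Row` (`lamCovector_eq_neg_lip1_curvAdj`, `lamCovector_Hcol`, `K1_row_straight_column_straight`), an5's straight
system `ResolventComposition.Hcol ∕ HΦcol`, and PART 21 (`tsum_lamR_mul_symLinKerAt_eq_straightCount`).  0 `def`, 0 `def … : Prop`, 0 sorry, nothing cited; no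
table VALUE, no estimate.  NOT (C1), NOT the wrapper's (K1), NOT D1, NEVER «G-an2-4 closed», NOT BetaPertH, NOT continuum, NOT Clay.

WHY (row D1 OWNER, gen 63; journal [AN2-G63-ONLINE] J-NOTE-1, [AN2-G63-INTENT-2] READING (3)).  Under J-NOTE-1's dictionary the road's (J-Λ) words (SPEC-51 §D (ii))
reduce to the (K1) row for the composite one-shot column with the fully transported weight `λ′ᴿ_0`; PART 21 put that weight's pairing in closed form (a straight
`L`-contour pullback of `Λ′_N`).  THIS FILE closes the `ℤ⁴` identity: the composite column differs from the block-mean-dressed straight column only by the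
corrector `Ψ̂ = 1 + c•dz∘ext∘ζ` (a fine pure gauge), the dressing `Π_bm` preserves `E″` and the `Λ′`-covector (g60), so `E″ colN = E″ ℋ` and `Λ′_N = λ′(ℋ) = −Φ^ℋ`,
and g60's straight (K1) transports VERBATIM.  What the road's torus instantiation still owes is periodisation∕index bookkeeping (J-NOTE-1), not content.

WHAT (all [folklore]; `L = Lc^(j+1)`, `[NeZero Lc]`, `R : Roots Lc`, `j : ℕ`, source label `(μ, y)`):
* §1 `colH_AN_apply` (`rfl` bridge to PARTs 14–21's spelling), **`colH_AN_eq_corrPsi_colH_coDress`** (`colN = Ψ_{j+1} (colH (coDressKBmAt (toSite (R.s (j+1))) L KInv) L μ y)`),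
  **`colH_AN_eq_corrPsi_coProjBmW_Hcol`** (`= Ψ_{j+1} (Π_bm ℋ_L(·; μ, y))`), `abs_colH_AN_le` ∕ `summable_colH_AN`.
* §2 **`curvAdj_curv_colH_AN`** (`E″ colN = E″ ℋ_L(·; μ, y)`), **`lamCovector_colH_AN_eq_Hcol`** (`λ′(colN) = λ′(ℋ)`), **`LamN_eq_neg_HΦcol`** (`Λ′_N μ y ν w = −Φ^ℋ_L(ν, w; μ, y)`).
* §3 **`K1_row_composite_column_straight`** (`(E″ colN)(f) = −Σ'_w Σ_ν Λ′_N μ y ν w·straightCount L ν w f`), `tsum_sum_LamN_straightCount_comm` (order of summation),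
  **`K1_row_composite_column_sym`** (`(E″ colN)(f) = −(Lc⁴)^{j+1}·Σ_{κ₁} Σ'_{s₁} λ′ᴿ_j (κ₁,s₁)·symLinKerAt (toSite R.r) Lc κ₁ s₁ f`).

HONEST DEPENDENCY (verbatim): «continuum YM on T⁴ ⇐ BetaPertH ∧ nine spine estimates (0/9 proved); BetaPertH ⇐ (D1) ∧ (D4) ∧ CAP+tail;
G-an2-4 gates asym, D1 and NE2/3/4.»  ABSOLUTE RULE (cell, verbatim): «No internally-minted statement may enter as a cited fact. Every
hypothesis is either kernel-proved in this package or a verbatim quotation of a PUBLISHED theorem with page reference.»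
Unit `b2b-balaban-beta-an2` gen 63 (row-D1 owner), 2026-08-27; `bears_on: R4-O/T1|T1a` (a (C1)-side identity behind the displayed row (K1); moves no node counter).
No existing file touched.
-/

noncomputable section

open scoped BigOperators

namespace Summit.QuantumFields.BalabanUV.Beta.NVertexColumnK1Row

open Finset
open Literature.MathematicalPhysics.QuantumFieldTheory
open Literature.MathematicalPhysics.QuantumFieldTheory.Balaban1983to89
open Literature.MathematicalPhysics.QuantumFieldTheory.Balaban1983to89.Beta
open B12Sec2to5 (l1)
open AffineAveraging (Form1 Site box toSite curv curvAdj)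
open AveragingHessianKernels (Bond straightCount)
open ExpKernelCalculus (MKer Decays comp)
open OneStepResolventKernel (Fib KInv)
open OneStepKernelFamily (colH)
open ResolventComposition (Hcol HΦcol Hcol_bdd_summable)
open BalabanStepJets (lamCoeffOf)
open KKTFluctuationEnergy (lip1 summable_of_exp_bound abs_le_of_exp_bound)
open Summit.QuantumFields.BalabanUV.Beta.TameKernelCalculus (trK)
open Summit.QuantumFields.BalabanUV.Beta.AxialDressingRooted (coProjBmW coDressKBmAt one_le_of_neZero)
open Summit.QuantumFields.BalabanUV.Beta.SymAveragingHessianCounts (symLinKerAt)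
open Summit.QuantumFields.BalabanUV.Beta.CompositeVertexKernelRec (compLinKer)
open Summit.QuantumFields.BalabanUV.Beta.CompositeCorrectorForms (corrPsi curv_corrPsi)
open Summit.QuantumFields.BalabanUV.Beta.CompositeCorrectorKernel (psiK comp_psiK_inl comp_trK_psiK_inr)
open Summit.QuantumFields.BalabanUV.Beta.CompositeCorrectorDress (compChart)
open Summit.QuantumFields.BalabanUV.Beta.CompositeOneShotJetData (Roots AN AN_eq)
open Summit.QuantumFields.BalabanUV.Beta.NVertexSectors (decays_AN)
open Summit.QuantumFields.BalabanUV.Beta.StraightColumnK1Row (lamCovector_eq_neg_lip1_curvAdj lamCovector_Hcol K1_row_straight_column_straight)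
open Summit.QuantumFields.BalabanUV.Beta.BlockMeanChartK1Row (coProjBmW_Hcol_eq_colH_coDressKBmAt curvAdj_curv_coProjBmW lamCovector_coProjBmW)
open Summit.QuantumFields.BalabanUV.Beta.CoclosedCovectorLinearRowsNear (summable_of_near straightCount_eq_zero_of_not_near)
open Summit.QuantumFields.BalabanUV.Beta.NVertexLamStraightPullback (abs_AN_col_le summable_AN_col LamN_eq_tsum_sum tsum_lamR_mul_symLinKerAt_eq_straightCount)

variable {Lc : ℕ} [NeZero Lc] (R : Roots Lc) (j : ℕ)

/-! ## §1 The composite column is the corrector applied to the block-mean-dressed straight column -/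

section Column

/-- [folklore] `rfl` bridge: `colH (AN R j) L μ y κ′ u = (AN R j) u (L•y) (inl κ′) (inr μ)` — PARTs 14–21's spelling of the column. -/
theorem colH_AN_apply (μ : Fin (3 + 1)) (y : Site (3 + 1)) (κ' : Fin (3 + 1)) (u : Site (3 + 1)) :
    colH (AN R j) (Lc ^ (j + 1)) μ y κ' u = AN R j u (((Lc ^ (j + 1) : ℕ) : ℤ) • y) (Sum.inl κ') (Sum.inr μ) := rfl

/-- [folklore] **`colH_AN_eq_corrPsi_colH_coDress` — THE COMPOSITE COLUMN IS THE CORRECTOR APPLIED TO THE CO-DRESSED STRAIGHT COLUMN**: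
`colH (AN R j) L μ y = Ψ_{j+1} (colH (coDressKBmAt (toSite (R.s (j+1))) L KInv) L μ y)` — `AN = Ψ̂∘(co-dressed KInv)∘Ψ̂ᵀ` read through the two apply bridges
(the right `Ψ̂ᵀ` is the identity on the multiplier source, the left `Ψ̂` acts on the column as the Form-level corrector `corrPsi`). -/
theorem colH_AN_eq_corrPsi_colH_coDress (μ : Fin (3 + 1)) (y : Site (3 + 1)) :
    colH (AN R j) (Lc ^ (j + 1)) μ y
      = corrPsi R.rc Lc (j + 1) (colH (coDressKBmAt (toSite (R.s (j + 1))) (Lc ^ (j + 1)) (KInv (N := Lc ^ (j + 1)) (d := 3))) (Lc ^ (j + 1)) μ y) := by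
  have hL : 0 < Lc := Nat.pos_of_ne_zero (NeZero.ne Lc)
  funext κ' u
  rw [colH, AN_eq, compChart, comp_trK_psiK_inr, comp_psiK_inl hL R.hrc (j + 1)]
  rfl

/-- [folklore] **`colH_AN_eq_corrPsi_coProjBmW_Hcol`**: `colH (AN R j) L μ y = Ψ_{j+1} (Π_bm ℋ_L(·; μ, y))` (g60 PART 7's dictionary `coProjBmW_Hcol_eq_colH_coDressKBmAt`). -/
theorem colH_AN_eq_corrPsi_coProjBmW_Hcol (μ : Fin (3 + 1)) (y : Site (3 + 1)) :
    colH (AN R j) (Lc ^ (j + 1)) μ y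
      = corrPsi R.rc Lc (j + 1) (coProjBmW (toSite (R.s (j + 1))) (Lc ^ (j + 1)) (Hcol (N := Lc ^ (j + 1)) μ y)) := by
  rw [colH_AN_eq_corrPsi_colH_coDress, coProjBmW_Hcol_eq_colH_coDressKBmAt]

/-- [folklore] the composite column is bounded by the chart's decay constant. -/
theorem exists_abs_colH_AN_le (μ : Fin (3 + 1)) (y : Site (3 + 1)) :
    ∃ C : ℝ, ∀ (κ' : Fin (3 + 1)) (u : Site (3 + 1)), |colH (AN R j) (Lc ^ (j + 1)) μ y κ' u| ≤ C := by
  obtain ⟨δ, C, hδ, hC, hK⟩ := decays_AN R j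
  exact ⟨C, fun κ' u => abs_le_of_exp_bound hδ hC _ (abs_AN_col_le R j hK μ κ' y) u⟩

/-- [folklore] the composite column is summable in its fine site (PART 21 `summable_AN_col`). -/
theorem summable_colH_AN (μ : Fin (3 + 1)) (y : Site (3 + 1)) (κ' : Fin (3 + 1)) : Summable (colH (AN R j) (Lc ^ (j + 1)) μ y κ') :=
  summable_AN_col R j μ κ' y

end Column

/-! ## §2 Hessian image and `Λ′`-covector of the composite column -/

section Images

/-- [folklore] **`curvAdj_curv_colH_AN` — THE COMPOSITE COLUMN HAS THE STRAIGHT COLUMN's HESSIAN IMAGE**: `E″(1) (colH (AN R j) L μ y) = E″(1) ℋ_L(·; μ, y)`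
(`curv_corrPsi`: the corrector adds a fine pure gauge; `curvAdj_curv_coProjBmW`: so does the block-mean dressing, root `R.s (j+1)` in its block). -/
theorem curvAdj_curv_colH_AN (μ : Fin (3 + 1)) (y : Site (3 + 1)) :
    curvAdj (curv (colH (AN R j) (Lc ^ (j + 1)) μ y)) = curvAdj (curv (Hcol (N := Lc ^ (j + 1)) μ y)) := by
  rw [colH_AN_eq_corrPsi_coProjBmW_Hcol, curv_corrPsi, curvAdj_curv_coProjBmW (one_le_of_neZero _) (R.hs (j + 1))]

/-- [folklore] **`lamCovector_colH_AN_eq_Hcol` — THE `Λ′`-COVECTOR OF THE COMPOSITE COLUMN IS THAT OF THE STRAIGHT COLUMN**: for every slot `(ν, w)`,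
`Σ'_x Σ_{κ′} lamCoeffOf (KInv L) L ν w κ′ x·colN κ′ x = Σ'_x Σ_{κ′} lamCoeffOf (KInv L) L ν w κ′ x·ℋ_L(·; μ, y) κ′ x` (both sides are `−⟨E″(·), ℋ_L(·; ν, w)⟩` by g60's
`lamCovector_eq_neg_lip1_curvAdj`, and the Hessian images agree). -/
theorem lamCovector_colH_AN_eq_Hcol (μ : Fin (3 + 1)) (y : Site (3 + 1)) (ν : Fin (3 + 1)) (w : Site (3 + 1)) :
    (∑' x : Site (3 + 1), ∑ κ' : Fin (3 + 1), lamCoeffOf (KInv (N := Lc ^ (j + 1)) (d := 3)) (Lc ^ (j + 1)) ν w κ' x * colH (AN R j) (Lc ^ (j + 1)) μ y κ' x)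
      = ∑' x : Site (3 + 1), ∑ κ' : Fin (3 + 1), lamCoeffOf (KInv (N := Lc ^ (j + 1)) (d := 3)) (Lc ^ (j + 1)) ν w κ' x * Hcol (N := Lc ^ (j + 1)) μ y κ' x := by
  obtain ⟨C, hb⟩ := exists_abs_colH_AN_le R j μ y
  obtain ⟨C', -, hb', hs'⟩ := Hcol_bdd_summable (N := Lc ^ (j + 1)) (d := 3)
  rw [lamCovector_eq_neg_lip1_curvAdj hb (summable_colH_AN R j μ y) ν w, curvAdj_curv_colH_AN,
    ← lamCovector_eq_neg_lip1_curvAdj (hb' μ y) (hs' μ y) ν w]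

/-- [folklore] **`LamN_eq_neg_HΦcol` — THE CONTRACTED MULTIPLIER RESPONSE IS MINUS THE STRAIGHT COLUMN's OWN MULTIPLIER, AT EVERY DEPTH**:
`Λ′_N μ y ν w = −Φ^ℋ_L(ν, w; μ, y)` (`L = Lc^(j+1)`; PART 21's exchange, §2, g60 `lamCovector_Hcol`). -/
theorem LamN_eq_neg_HΦcol (μ ν : Fin (3 + 1)) (y w : Site (3 + 1)) :
    (∑ κ' : Fin (3 + 1), ∑' u : Site (3 + 1),
        AN R j u (((Lc ^ (j + 1) : ℕ) : ℤ) • y) (Sum.inl κ') (Sum.inr μ) * lamCoeffOf (KInv (N := Lc ^ (j + 1)) (d := 3)) (Lc ^ (j + 1)) ν w κ' u)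
      = -HΦcol (N := Lc ^ (j + 1)) μ y ν w := by
  rw [LamN_eq_tsum_sum R j μ ν y w, ← lamCovector_Hcol (N := Lc ^ (j + 1)) μ y ν w, ← lamCovector_colH_AN_eq_Hcol R j μ y ν w]
  rfl

end Images

/-! ## §3 (K1) for the composite one-shot column -/

section K1

/-- [folklore] **`K1_row_composite_column_straight` — (K1) FOR THE COMPOSITE COLUMN, STRAIGHT ROWS**: for every fine bond `f`,
`(E″(1) colN)(f) = −Σ'_w Σ_ν Λ′_N μ y ν w·straightCount L ν w f` (g60 `K1_row_straight_column_straight` transported by §2). -/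
theorem K1_row_composite_column_straight (μ : Fin (3 + 1)) (y : Site (3 + 1)) (f : Bond (3 + 1)) :
    curvAdj (curv (colH (AN R j) (Lc ^ (j + 1)) μ y)) f.1 f.2
      = -∑' w : Site (3 + 1), ∑ ν : Fin (3 + 1),
          (∑ κ' : Fin (3 + 1), ∑' u : Site (3 + 1),
              AN R j u (((Lc ^ (j + 1) : ℕ) : ℤ) • y) (Sum.inl κ') (Sum.inr μ) * lamCoeffOf (KInv (N := Lc ^ (j + 1)) (d := 3)) (Lc ^ (j + 1)) ν w κ' u)
            * (straightCount (Lc ^ (j + 1)) ν w f : ℝ) := by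
  rw [curvAdj_curv_colH_AN, K1_row_straight_column_straight (N := Lc ^ (j + 1)) μ y f]
  congr 1
  refine tsum_congr fun w => Finset.sum_congr rfl fun ν _ => ?_
  rw [← lamCovector_colH_AN_eq_Hcol R j μ y ν w, LamN_eq_tsum_sum R j μ ν y w]
  rfl

/-- [folklore] order of summation of the straight pairing (finite support in `w` for each `ν`). -/
theorem tsum_sum_LamN_straightCount_comm (μ : Fin (3 + 1)) (y : Site (3 + 1)) (f : Bond (3 + 1)) :
    (∑' w : Site (3 + 1), ∑ ν : Fin (3 + 1),
        (∑ κ' : Fin (3 + 1), ∑' u : Site (3 + 1),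
            AN R j u (((Lc ^ (j + 1) : ℕ) : ℤ) • y) (Sum.inl κ') (Sum.inr μ) * lamCoeffOf (KInv (N := Lc ^ (j + 1)) (d := 3)) (Lc ^ (j + 1)) ν w κ' u)
          * (straightCount (Lc ^ (j + 1)) ν w f : ℝ))
      = ∑ ν : Fin (3 + 1), ∑' w : Site (3 + 1),
          (∑ κ' : Fin (3 + 1), ∑' u : Site (3 + 1),
              AN R j u (((Lc ^ (j + 1) : ℕ) : ℤ) • y) (Sum.inl κ') (Sum.inr μ) * lamCoeffOf (KInv (N := Lc ^ (j + 1)) (d := 3)) (Lc ^ (j + 1)) ν w κ' u)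
            * (straightCount (Lc ^ (j + 1)) ν w f : ℝ) := by
  refine Summable.tsum_finsetSum fun ν _ => summable_of_near (pow_pos (Nat.pos_of_ne_zero (NeZero.ne Lc)) (j + 1)) f.2 fun w hw => ?_
  rw [straightCount_eq_zero_of_not_near ν hw, Int.cast_zero, mul_zero]

/-- [folklore] **`K1_row_composite_column_sym` — (K1) FOR THE COMPOSITE ONE-SHOT COLUMN WITH THE FULLY TRANSPORTED WEIGHT, (0.4)-SYMMETRISED ROWS, EVERY DEPTH**:
for every fine bond `f`,
`(E″(1) colN)(f) = −(Lc⁴)^{j+1} · Σ_{κ₁} Σ'_{s₁} λ′ᴿ_j (κ₁,s₁) · symLinKerAt (toSite R.r) Lc κ₁ s₁ f`,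
`λ′ᴿ_j (κ₁,s₁) = Σ_ν Σ'_w Λ′_N μ y ν w · compLinKer (fun _ => symLinKerAt (toSite R.r) Lc) Lc j (κ₁,s₁) (ν,w)` — the END wrapper's finest-level (K1) SHAPE
`c·Ê″·h = w·Σ_slot λ(slot)·symLinKerAt ρ Lc slot (·)` for the composite column on `ℤ⁴`, with `λ := λ′ᴿ_j` (an2 storey 0 = J-NOTE-1's `λ′ᴿ_0` in the wrapper's count)
and `α = −(Lc⁴)^{j+1}` (§3's straight form through PART 21 `tsum_lamR_mul_symLinKerAt_eq_straightCount`). -/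
theorem K1_row_composite_column_sym (μ : Fin (3 + 1)) (y : Site (3 + 1)) (f : Bond (3 + 1)) :
    curvAdj (curv (colH (AN R j) (Lc ^ (j + 1)) μ y)) f.1 f.2
      = -((Lc : ℝ) ^ (3 + 1)) ^ (j + 1) * ∑ κ₁ : Fin (3 + 1), ∑' s₁ : Site (3 + 1),
          (∑ ν : Fin (3 + 1), ∑' w : Site (3 + 1),
              (∑ κ' : Fin (3 + 1), ∑' u : Site (3 + 1),
                  AN R j u (((Lc ^ (j + 1) : ℕ) : ℤ) • y) (Sum.inl κ') (Sum.inr μ) * lamCoeffOf (KInv (N := Lc ^ (j + 1)) (d := 3)) (Lc ^ (j + 1)) ν w κ' u)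
                * compLinKer (fun _ => symLinKerAt (toSite R.r) Lc) Lc j (κ₁, s₁) (ν, w))
            * symLinKerAt (toSite R.r) Lc κ₁ s₁ f := by
  have hLc : (Lc : ℝ) ≠ 0 := Nat.cast_ne_zero.mpr (NeZero.ne Lc)
  rw [K1_row_composite_column_straight, tsum_sum_LamN_straightCount_comm,
    show f = (f.1, f.2) from rfl, tsum_lamR_mul_symLinKerAt_eq_straightCount R j j μ f.1 y f.2, ← mul_assoc, neg_mul, ← mul_pow,
    mul_inv_cancel₀ (pow_ne_zero _ hLc), one_pow, neg_one_mul]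

end K1

end Summit.QuantumFields.BalabanUV.Beta.NVertexColumnK1Row

end
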